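import Summits.Schanuel.Schanuel.Theorems.RootDecomp1KSectorTheorem06

/-!
# RootDecomp1KSectorTheorem — lens 1, generation 67, NODE 27 «THE SECTOR THEOREM BY ONE NEWTON STEP AT (∞,∞) — THE EDGE ENGINE» — FORK (B): the FIRST-ORDER SECTOR THEOREM at FLOOR F (`thinFibreAt_of_sectorCond : c k ≠ 0 → DomZero k c → SectorCond m₀ k c → ThinFibreAt m₀ (xPolyP k c)`, every m₀ / k / monomial support, the only escape the typed residue `Residue m₀ k c`; one PROVED Diophantine input `Ridout.padicRoth_int`; CLAIM L3031, PRICE L3032, ADDENDUM L3037, RULE K-R58, NODE L3047, VERDICT L3050) — continuation (RootDecomp1KSectorTheorem07): (continuation of the previous §) — 14 declarations `layerPoly_lin2` … `natDegree_scaleShift`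

(lens-1 g67 NODE 27 «THE SECTOR THEOREM BY ONE NEWTON STEP AT (∞,∞) — THE EDGE ENGINE» L3047: HOME kernel K = HOME/decomp-schanuel-lens-1/g67/lean/SectorTheorem.lean sha256 bbe43d14…, 2869 l, ONE namespace `Summit.Schanuel.Schanuel.Theorems.RootDecomp1KSectorTheorem`, imports the tree port …RootDecomp1KDigitPincer03 ONLY (node 26's record port; its closure holds every cell file used); no private / instance / set_option / notation / sorry / new axiom / binder / `decide` on levels; lens farm rc 0 · 0 errors · 0 sorries · warnings dupNamespace only, `--axioms` standard on the 18 deciding declarations, Probe rc 0 (g67/out/); memo g67/NODE-g67.md; CLAIM L3031 (ASK-FIRST under K-R57 (iii)); crit g12 PRICE L3032 (fork (A) ×0-AS-RECORD as posted / fork (B) a kernel meeting FLOOR F = «FIRST-ORDER SECTOR THEOREM» = THEOREM ×1 consuming K-R57 (iii); CHECKLIST K-g67 F1–F6 + S1–S8; RULE K-R58 PRE-ANNOUNCED) and PRICE ADDENDUM L3037 ((F6′) `W4P` by tree name; the ρ3 specimen `x² + x·Y² + Y⁵ + 3` of writer NOTE 17 L3036 = the F5 exhibit); census instruments LIVENESS-v36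 (key edge) / v37 (key ls2); crit g12 VERDICT L3050 (2026-09-02T03:35Z): THEOREM ×1 GRANTED under K-R57 (iii) for FORK (B) = the FIRST-ORDER SECTOR THEOREM AT FLOOR F (F1 F2 F3 (T) F4(α) F4(β) F5 F6 F6′ R-27-i and CHECKLIST S1–S8 met on the critic's own farm runs), the single ×1 of the sector line CONSUMED (K-R58 (i): no further ×1 on this line), TALLY lens-1 ×22 + THEOREM ×24, RULE K-R58 FIXED (PRICE L3032 (i)–(v) verbatim with the ADDENDUM L3037 gloss; W-27-2 = a ×0 wish for typed stratum predicates), PORT GO → census-1 (this port; PORT IDENTITY 27 owed by the seated critic). Port by census-1 gen 25 as `RootDecomp1KSectorTheorem01–10` (files ≤ 400 lines; `--supports stmt-Schanuel-33364`, the item stays OPEN; no census credit carried; RULE K-R58 (iv): UNCONDITIONAL PART ∪= these names): 01 = K l.1–307 of the prepped source (opens §1 / §2 / §3) — 20 decls `dMax`, `box`, `supp`, …, `two_zpow_inj`; 02 = K l.308–570 of the prepped source (opens §4) — 5 decls `far_pair`, `natDegree_le_dMax`, `norm_pow_sub_one_le`, …, `mem_supp`; 03 = K l.571–896 of the prepped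 source (opens §4b / §5) — 12 decls `layered_bound`, `edge_bound_one`, `edge_bound_crude`, …, `tendsto_partialSum_two`; 04 = K l.897–1221 of the prepped source (opens §6 / §7) — 10 decls `arch_finite`, `ridout_two`, `lt_rpow_neg_of_pow_mul_pow_lt`, …, `factorial_pred_le_div`; 05 = K l.1222–1500 of the prepped source (opens §8) — 4 decls `pair_levels_finite`, `dvd_lc_pow_val`, `den_le_of_dvd`, `den_rescaled_le`; 06 = K l.1501–1822 of the prepped source (opens §9) — 13 decls `size_regime`, `c_zero_ne_zero`, `far_levels_finite`, …, `sum_range_ite_shift`; 07 = K l.1823–2080 of the prepped source (inside §9) — 14 decls `layerPoly_lin2`, `layer0_lin2`, `layer1_lin2`, …, `natDegree_scaleShift`; 08 = K l.2081–2401 of the prepped source (opens §10) — 18 decls `thinFibreAt_xLinear`, `thinFibreAt_xPolyP_one`, `edgeGood_of_gap`, …, `thinFibreAt_M_sector`; 09 = K l.2402–2627 of the prepped source (opens §11) — 17 decls `sectorCond_beta0_example`, `thinFibreAt_beta0_example`, `thinFibreAt_generic_xLinear_example`, …, `rho2_two`; 10 = K l.2628–2905 of the prepped source (opens §12) — 13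 decls `residue_rho2`, `rho3`, `rho3_zero`, …, `W4P_eq`. 39 one-line docstrings synthesised for undocumented helper declarations (statements quoted, census port convention since gen 22); everything else = K VERBATIM (statements, names, proofs, K's module docstring kept in part 01 below this provenance block).)
-/

noncomputable section

namespace Summit.Schanuel.Schanuel.Theorems.RootDecomp1KSectorTheorem

open Polynomial LiouvilleNumber
open scoped Nat
open Summit.Schanuel.Schanuel.Theorems.RootDecomp1KTwoBaseCell (psNumer partialSum_eq_psNumer_div coprime_psNumer)
open Summit.Schanuel.Schanuel.Theorems.RootDecomp1KRelLiouvilleCell (partialSum_two_strictMono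
  abs_liouvilleNumber_two_sub_partialSum)
open Summit.Schanuel.Schanuel.Theorems.RootDecomp1KDegreeLadder
open Summit.Schanuel.Schanuel.Theorems.RootDecomp1KXLinear (xLinP bev_xLinP norm_ratCast_two norm_ratCast_of_le
  norm_psNumer_sub_one)
open Summit.Schanuel.Schanuel.Theorems.RootDecomp1KDigitPincer (xc XP X6P)
open Summit.Schanuel.Schanuel.Theorems.RootDecomp1KOddEmpty (W4P w4C vG natDegree_vG)
open Summit.Schanuel.Schanuel.Theorems.RootDecomp1KHyperellipticSiegel (mQ mC mC_zero mC_one mC_two natDegree_mQ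
  coeff_mQ_five leadingCoeff_mQ)
open Summit.Schanuel.Schanuel.Theorems.RootDecomp1KXLinearII (norm_aeval_le norm_psNumer)
open Summit.Schanuel.Schanuel.Theorems.RootDecomp1KXTop
open Summit.Schanuel.Schanuel.Theorems.RootDecomp1KXAll
open Summit.Schanuel.Schanuel.Theorems.RootDecomp1KLevelFinite
open Summit.Schanuel.Schanuel.Theorems.RootDecomp1KLocalExponent
open Summit.Schanuel.Schanuel.Theorems.RootDecomp1KIntegrality

/-- the layers of an `x`-linear presentation (`k = 1`, `s = 1`): at most one monomial of `A` and one of `B` each. -/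
theorem layerPoly_lin2 (A B : ℤ[X]) {d e : ℕ} (hA : A.natDegree ≤ d) (hBe : B.natDegree ≤ e) (q M g : ℕ)
    (hMd : M ≤ d + g) (hMe : M ≤ e + (q + g)) :
    layerPoly 1 (lin2 A B) 1 q M g =
      (if g ≤ M then C (A.coeff (M - g)) * X ^ (M - g) else 0) +
      (if q + g ≤ M then C (B.coeff (M - (q + g))) * X ^ (M - (q + g)) else 0) := by
  classical
  have hS : ∀ p ∈ ({0} ×ˢ Finset.range (d + 1) ∪ {1} ×ˢ Finset.range (e + 1) : Finset (ℕ × ℕ)), p.1 ≤ 1 := by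
    intro p hp
    simp only [Finset.mem_union, Finset.mem_product, Finset.mem_singleton] at hp
    rcases hp with ⟨h, -⟩ | ⟨h, -⟩ <;> omega
  have hsupp : ∀ p : ℕ × ℕ, p.1 ≤ 1 → ((lin2 A B) p.1).coeff p.2 ≠ 0 →
      p ∈ ({0} ×ˢ Finset.range (d + 1) ∪ {1} ×ˢ Finset.range (e + 1) : Finset (ℕ × ℕ)) := by
    rintro ⟨j, i⟩ hj hc
    dsimp only at hj hc
    simp only [Finset.mem_union, Finset.mem_product, Finset.mem_singleton, Finset.mem_range]
    interval_cases j
    · left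
      rw [lin2_zero] at hc
      exact ⟨rfl, Nat.lt_succ_of_le ((le_natDegree_of_ne_zero hc).trans hA)⟩
    · right
      rw [lin2_one] at hc
      exact ⟨rfl, Nat.lt_succ_of_le ((le_natDegree_of_ne_zero hc).trans hBe)⟩
  have hdisj : Disjoint ({0} ×ˢ Finset.range (d + 1) : Finset (ℕ × ℕ)) ({1} ×ˢ Finset.range (e + 1)) := by
    rw [Finset.disjoint_left]
    rintro ⟨j, i⟩ h0 h1
    simp only [Finset.mem_product, Finset.mem_singleton] at h0 h1
    omega
  rw [layerPoly_eq_sum 1 (lin2 A B) _ hS hsupp, Finset.sum_filter, Finset.sum_union hdisj,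
    Finset.sum_product, Finset.sum_singleton, Finset.sum_product, Finset.sum_singleton]
  simp only [lin2_zero, lin2_one, mul_zero, zero_add, mul_one, one_mul]
  congr 1
  · exact sum_range_ite_shift (fun i => C (A.coeff i) * X ^ i) hMd
  · rw [← sum_range_ite_shift (fun i => C (B.coeff i) * X ^ i) hMe]
    refine Finset.sum_congr rfl fun i _ => ?_
    exact if_congr (by constructor <;> intro h <;> omega) rfl rfl

/-- the EDGE POLYNOMIAL of `A + x·B` (`deg A = d ≥ e ≥ deg B`): `f = A_d·W^d + B_e·W^e`. -/
theorem layer0_lin2 (A B : ℤ[X]) {d e : ℕ} (hA : A.natDegree ≤ d) (hBe : B.natDegree ≤ e) (hed : e ≤ d) :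
    layerPoly 1 (lin2 A B) 1 (d - e) d 0 = C (A.coeff d) * X ^ d + C (B.coeff e) * X ^ e := by
  rw [layerPoly_lin2 A B hA hBe (d - e) d 0 (by omega) (by omega), if_pos (by omega), if_pos (by omega),
    show d - (d - e + 0) = e by omega, Nat.sub_zero]

/-- the FIRST LAYER of `A + x·B`: `f_1 = A_{d−1}·W^{d−1} + B_{e−1}·W^{e−1}` (`B_{−1} := 0`). -/
theorem layer1_lin2 (A B : ℤ[X]) {d e : ℕ} (hA : A.natDegree ≤ d) (hBe : B.natDegree ≤ e) (hed : e + 2 ≤ d) :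
    layerPoly 1 (lin2 A B) 1 (d - e) d 1 =
      C (A.coeff (d - 1)) * X ^ (d - 1) + (if 1 ≤ e then C (B.coeff (e - 1)) * X ^ (e - 1) else 0) := by
  rw [layerPoly_lin2 A B hA hBe (d - e) d 1 (by omega) (by omega), if_pos (by omega)]
  congr 1
  by_cases he : 1 ≤ e
  · rw [if_pos (by omega), if_pos he, show d - (d - e + 1) = e - 1 by omega]
  · rw [if_neg (by omega), if_neg he]

/-- `{m : ℤ} (hm : m ≠ 0) : (m : PadicAlgCl 2) ≠ 0`. -/
theorem intCast_ne_zero_st {m : ℤ} (hm : m ≠ 0) : (m : PadicAlgCl 2) ≠ 0 := by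
  rw [← norm_pos_iff, norm_intCast_eq_zpow hm]; positivity

/-- **THE PROPORTIONAL `x`-LINEAR EDGE IS GOOD.**  For `A + x·B` with `deg B + 2 ≤ deg A` and the proportionality
`A_{d−1}·B_e = A_d·B_{e−1}` (which the canonical shift `Y ↦ (Y + a)/b` always achieves, below), the single edge
(slope `1/q`, `q = d − e ≥ 2`, `f = A_d W^d + B_e W^e`) is good: every non-zero root `β` (`β^q = −B_e/A_d`) is
SIMPLE and the first layer `f_1` VANISHES AT `β` — branch (R) of `RootGood` with `L = 2 > s = 1`, `q > 1`; no
`ℚ₂`-membership analysis is needed. -/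
theorem edgeGood_lin2 (A B : ℤ[X]) (hB : B ≠ 0) {d e : ℕ} (hd : A.natDegree = d) (he : B.natDegree = e)
    (hdeg : e + 2 ≤ d)
    (hprop : A.coeff (d - 1) * B.coeff e = A.coeff d * (if 1 ≤ e then B.coeff (e - 1) else 0)) :
    EdgeGood 1 (lin2 A B) 1 (d - e) := by
  classical
  have hA0 : A ≠ 0 := by
    rintro rfl
    rw [natDegree_zero] at hd
    omega
  have ha : A.coeff d ≠ 0 := by rw [← hd]; exact leadingCoeff_ne_zero.mpr hA0
  have hb : B.coeff e ≠ 0 := by rw [← he]; exact leadingCoeff_ne_zero.mpr hB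
  have hf0 := layer0_lin2 A B hd.le he.le (by omega)
  have hf1 := layer1_lin2 A B hd.le he.le hdeg
  refine ⟨d, ⟨?_, ?_⟩, ?_⟩
  · intro p hp
    obtain ⟨hj, -, hc⟩ := mem_supp hp
    rcases p with ⟨j, i⟩
    dsimp only at hj hc ⊢
    interval_cases j
    · rw [lin2_zero] at hc
      have := le_natDegree_of_ne_zero hc
      omega
    · rw [lin2_one] at hc
      have := le_natDegree_of_ne_zero hc
      omega
  · rw [hf0]
    intro h
    have := congrArg (fun P : ℤ[X] => P.coeff d) h
    simp only [coeff_add, coeff_C_mul_X_pow, coeff_zero, if_neg (by omega : ¬ d = e),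
      add_zero] at this
    exact ha this
  · intro β hβ0 hroot
    rw [hf0] at hroot
    have hroot' : ((A.coeff d : ℤ) : PadicAlgCl 2) * β ^ d + ((B.coeff e : ℤ) : PadicAlgCl 2) * β ^ e = 0 := by
      simpa only [map_add, map_mul, aeval_C, map_pow, aeval_X, algebraMap_int_eq, eq_intCast, map_intCast]
        using hroot
    have haC : ((A.coeff d : ℤ) : PadicAlgCl 2) ≠ 0 := intCast_ne_zero_st ha
    have hbC : ((B.coeff e : ℤ) : PadicAlgCl 2) ≠ 0 := intCast_ne_zero_st hb
    have hqC : (d : PadicAlgCl 2) - (e : PadicAlgCl 2) ≠ 0 := by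
      have := intCast_ne_zero_st (m := (d : ℤ) - e) (by omega)
      push_cast at this
      exact this
    have hβe : β ^ e ≠ 0 := pow_ne_zero _ hβ0
    have hd1 : 1 ≤ d := by omega
    refine Or.inr (Or.inr ⟨?_, 2, ?_, by omega, by omega⟩)
    · -- `β · f'(β) = d·f(β) − (d − e)·B_e·β^e = −q·B_e·β^e ≠ 0`
      rw [hf0, derivative_add, derivative_C_mul_X_pow, derivative_C_mul_X_pow]
      intro hder
      have hder' : ((A.coeff d : ℤ) : PadicAlgCl 2) * (d : PadicAlgCl 2) * β ^ (d - 1) +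
          ((B.coeff e : ℤ) : PadicAlgCl 2) * (e : PadicAlgCl 2) * β ^ (e - 1) = 0 := by
        simpa only [map_add, map_mul, aeval_C, map_pow, aeval_X, algebraMap_int_eq, eq_intCast, map_intCast,
          Int.cast_mul, Int.cast_natCast, map_natCast] using hder
      have hkey : ((d : PadicAlgCl 2) - (e : PadicAlgCl 2)) * (((B.coeff e : ℤ) : PadicAlgCl 2) * β ^ e) = 0 := by
        rcases Nat.eq_zero_or_pos e with he0 | he1
        · subst he0
          simp only [Nat.cast_zero, mul_zero, zero_mul, add_zero, pow_zero, mul_one, sub_zero] at hder' hroot' ⊢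
          have h1 : β ^ (d - 1) * β = β ^ d := by rw [← pow_succ, Nat.sub_add_cancel hd1]
          have h2 : ((A.coeff d : ℤ) : PadicAlgCl 2) * β ^ d = -((B.coeff 0 : ℤ) : PadicAlgCl 2) :=
            eq_neg_of_add_eq_zero_left hroot'
          have h3 : ((A.coeff d : ℤ) : PadicAlgCl 2) * (d : PadicAlgCl 2) * β ^ (d - 1) * β = 0 := by
            rw [hder', zero_mul]
          rw [mul_assoc, h1, mul_comm _ (d : PadicAlgCl 2), mul_assoc, h2] at h3
          linear_combination -h3
        · have h1 : β ^ (d - 1) * β = β ^ d := by rw [← pow_succ, Nat.sub_add_cancel hd1]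
          have h1' : β ^ (e - 1) * β = β ^ e := by rw [← pow_succ, Nat.sub_add_cancel he1]
          have h3 : (((A.coeff d : ℤ) : PadicAlgCl 2) * (d : PadicAlgCl 2) * β ^ (d - 1) +
              ((B.coeff e : ℤ) : PadicAlgCl 2) * (e : PadicAlgCl 2) * β ^ (e - 1)) * β = 0 := by
            rw [hder', zero_mul]
          rw [add_mul, mul_assoc, h1, mul_assoc (((B.coeff e : ℤ) : PadicAlgCl 2) * (e : PadicAlgCl 2)), h1']
            at h3
          linear_combination (d : PadicAlgCl 2) * hroot' - h3
      exact (mul_ne_zero hqC (mul_ne_zero hbC hβe)) hkey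
    · -- the first layer vanishes at `β`: `aβ·f_1(β) = β^e·(A_d·B_{e−1} − A_{d−1}·B_e) = 0`
      intro g hg1 hg2
      obtain rfl : g = 1 := by omega
      rw [hf1]
      have hcancel : ((A.coeff d : ℤ) : PadicAlgCl 2) * β ≠ 0 := mul_ne_zero haC hβ0
      refine (mul_eq_zero.mp ?_).resolve_right hcancel
      have h1 : β ^ (d - 1) * β = β ^ d := by rw [← pow_succ, Nat.sub_add_cancel hd1]
      have h2 : ((A.coeff d : ℤ) : PadicAlgCl 2) * β ^ d = -(((B.coeff e : ℤ) : PadicAlgCl 2) * β ^ e) :=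
        eq_neg_of_add_eq_zero_left hroot'
      have hpropC : ((A.coeff (d - 1) : ℤ) : PadicAlgCl 2) * ((B.coeff e : ℤ) : PadicAlgCl 2) =
          ((A.coeff d : ℤ) : PadicAlgCl 2) * (((if 1 ≤ e then B.coeff (e - 1) else 0 : ℤ)) : PadicAlgCl 2) := by
        exact_mod_cast congrArg (fun z : ℤ => (z : PadicAlgCl 2)) hprop
      by_cases he1 : 1 ≤ e
      · rw [if_pos he1] at hpropC ⊢
        have h1' : β ^ (e - 1) * β = β ^ e := by rw [← pow_succ, Nat.sub_add_cancel he1]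
        simp only [map_add, map_mul, map_pow, aeval_X, eq_intCast, map_intCast]
        have : (((A.coeff (d - 1) : ℤ) : PadicAlgCl 2) * β ^ (d - 1) +
            ((B.coeff (e - 1) : ℤ) : PadicAlgCl 2) * β ^ (e - 1)) * (((A.coeff d : ℤ) : PadicAlgCl 2) * β) =
            ((A.coeff (d - 1) : ℤ) : PadicAlgCl 2) * (((A.coeff d : ℤ) : PadicAlgCl 2) * β ^ d) +
            ((A.coeff d : ℤ) : PadicAlgCl 2) * ((B.coeff (e - 1) : ℤ) : PadicAlgCl 2) * (β ^ (e - 1) * β) := by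
          rw [← h1]; ring
        rw [this, h1', h2]
        linear_combination (-(β ^ e)) * hpropC
      · rw [if_neg he1] at hpropC ⊢
        simp only [map_mul, map_pow, aeval_X, eq_intCast, map_intCast, add_zero]
        push_cast at hpropC
        have : ((A.coeff (d - 1) : ℤ) : PadicAlgCl 2) * β ^ (d - 1) * (((A.coeff d : ℤ) : PadicAlgCl 2) * β) =
            ((A.coeff (d - 1) : ℤ) : PadicAlgCl 2) * (((A.coeff d : ℤ) : PadicAlgCl 2) * β ^ d) := by
          rw [← h1]; ring
        rw [this, h2]
        linear_combination (-(β ^ e)) * hpropC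

/-- the proportional `x`-linear presentation satisfies the SECTOR CONDITION at every quality `m₀`. -/
theorem sectorCond_lin2 (A B : ℤ[X]) (hB : B ≠ 0) {d e : ℕ} (hd : A.natDegree = d) (he : B.natDegree = e)
    (hdeg : e + 2 ≤ d)
    (hprop : A.coeff (d - 1) * B.coeff e = A.coeff d * (if 1 ≤ e then B.coeff (e - 1) else 0)) (m₀ : ℕ) :
    SectorCond m₀ 1 (lin2 A B) := by
  intro j₁ j₂ hlt hle h1 h2 hdlt hm hhull
  obtain rfl : j₂ = 1 := by omega
  obtain rfl : j₁ = 0 := by omega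
  rw [lin2_zero, lin2_one, hd, he]
  exact edgeGood_lin2 A B hB hd he hdeg hprop

/-- **F4 (α), proportional form**: `ThinFibreAt m₀ (A + x·B)` at EVERY `m₀` for a proportional pair. -/
theorem thinFibreAt_lin2_of_prop (A B : ℤ[X]) (hB : B ≠ 0) {d e : ℕ} (hd : A.natDegree = d)
    (he : B.natDegree = e) (hdeg : e + 2 ≤ d)
    (hprop : A.coeff (d - 1) * B.coeff e = A.coeff d * (if 1 ≤ e then B.coeff (e - 1) else 0)) (m₀ : ℕ) :
    ThinFibreAt m₀ (xPolyP 1 (lin2 A B)) :=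
  thinFibreAt_of_sectorCond 1 (lin2 A B) (by rw [lin2_one]; exact hB)
    (fun j hj1 hj2 => by
      obtain rfl : j = 1 := le_antisymm hj2 hj1
      rw [lin2_one, lin2_zero]
      omega)
    (sectorCond_lin2 A B hB hd he hdeg hprop m₀)

/-- the Tschirnhaus–scaled polynomial `b^d · P((Y + a)/b) = Σ_i P_i · b^{d−i} · (Y + a)^i` (`deg P ≤ d`). -/
def scaleShift (P : ℤ[X]) (d : ℕ) (a : ℤ) (b : ℕ) : ℤ[X] :=
  ∑ i ∈ Finset.range (d + 1), C (P.coeff i * (b : ℤ) ^ (d - i)) * (X + C a) ^ i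

/-- `(P : ℤ[X]) {d : ℕ} (hP : P.natDegree ≤ d) (a : ℤ) (b : ℕ) (y : ℝ) : aeval ((b : ℝ) * y - a) (scaleShift P d a b) = (b : ℝ) ^ d * aeval y P`. -/
theorem aeval_scaleShift (P : ℤ[X]) {d : ℕ} (hP : P.natDegree ≤ d) (a : ℤ) (b : ℕ) (y : ℝ) :
    aeval ((b : ℝ) * y - a) (scaleShift P d a b) = (b : ℝ) ^ d * aeval y P := by
  rw [aeval_eq_sum_range' (Nat.lt_succ_of_le hP) y, scaleShift, map_sum, Finset.mul_sum]
  refine Finset.sum_congr rfl fun i hi => ?_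
  rw [Finset.mem_range] at hi
  rw [map_mul, aeval_C, map_pow, map_add, aeval_X, aeval_C, algebraMap_int_eq, eq_intCast, eq_intCast,
    sub_add_cancel, mul_pow, Int.cast_mul, Int.cast_pow, Int.cast_natCast, zsmul_eq_mul,
    show (b : ℝ) ^ d = (b : ℝ) ^ (d - i) * (b : ℝ) ^ i by rw [← pow_add, Nat.sub_add_cancel (by omega)]]
  ring

/-- `(P : ℤ[X]) (d : ℕ) (a : ℤ) (b : ℕ) (m : ℕ) : (scaleShift P d a b).coeff m = ∑ i ∈ Finset.range (d + 1), P.coeff i * (b : ℤ) ^ (d - i) * (a ^ (i - m) * (i.choose m : ℤ))`. -/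
theorem coeff_scaleShift (P : ℤ[X]) (d : ℕ) (a : ℤ) (b : ℕ) (m : ℕ) :
    (scaleShift P d a b).coeff m =
      ∑ i ∈ Finset.range (d + 1), P.coeff i * (b : ℤ) ^ (d - i) * (a ^ (i - m) * (i.choose m : ℤ)) := by
  rw [scaleShift, finsetSum_coeff]
  refine Finset.sum_congr rfl fun i _ => ?_
  rw [coeff_C_mul, coeff_X_add_C_pow]

/-- `(P : ℤ[X]) {d e : ℕ} (hP : P.natDegree ≤ e) (a : ℤ) (b : ℕ) {m : ℕ} (hm : e < m) : (scaleShift P d a b).coeff m = 0`. -/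
theorem coeff_scaleShift_of_lt (P : ℤ[X]) {d e : ℕ} (hP : P.natDegree ≤ e) (a : ℤ) (b : ℕ)
    {m : ℕ} (hm : e < m) : (scaleShift P d a b).coeff m = 0 := by
  rw [coeff_scaleShift]
  refine Finset.sum_eq_zero fun i _ => ?_
  by_cases hie : i ≤ e
  · rw [Nat.choose_eq_zero_of_lt (by omega), Nat.cast_zero, mul_zero, mul_zero]
  · rw [coeff_eq_zero_of_natDegree_lt (by omega), zero_mul, zero_mul]

/-- `(P : ℤ[X]) {d e : ℕ} (hP : P.natDegree ≤ e) (hed : e ≤ d) (a : ℤ) (b : ℕ) : (scaleShift P d a b).coeff e = P.coeff e * (b : ℤ) ^ (d - e)`. -/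
theorem coeff_scaleShift_self (P : ℤ[X]) {d e : ℕ} (hP : P.natDegree ≤ e) (hed : e ≤ d) (a : ℤ) (b : ℕ) :
    (scaleShift P d a b).coeff e = P.coeff e * (b : ℤ) ^ (d - e) := by
  rw [coeff_scaleShift, Finset.sum_eq_single e]
  · rw [Nat.sub_self, pow_zero, Nat.choose_self, Nat.cast_one, mul_one, mul_one]
  · intro i _ hi
    rcases lt_or_gt_of_ne hi with h | h
    · rw [Nat.choose_eq_zero_of_lt h, Nat.cast_zero, mul_zero, mul_zero]
    · rw [coeff_eq_zero_of_natDegree_lt (by omega), zero_mul, zero_mul]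
  · intro h
    rw [Finset.mem_range] at h
    omega

/-- `(P : ℤ[X]) {d e : ℕ} (hP : P.natDegree ≤ e) (hed : e ≤ d) (he : 1 ≤ e) (a : ℤ) (b : ℕ) : (scaleShift P d a b).coeff (e - 1) = P.coeff (e - 1) * (b : ℤ) ^ (d - e + 1) + P.coeff e * (b : ℤ) ^ (d - e) * (a * e)`. -/
theorem coeff_scaleShift_pred (P : ℤ[X]) {d e : ℕ} (hP : P.natDegree ≤ e) (hed : e ≤ d) (he : 1 ≤ e) (a : ℤ)
    (b : ℕ) : (scaleShift P d a b).coeff (e - 1) =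
      P.coeff (e - 1) * (b : ℤ) ^ (d - e + 1) + P.coeff e * (b : ℤ) ^ (d - e) * (a * e) := by
  rw [coeff_scaleShift, Finset.sum_eq_add_of_mem (e - 1) e (Finset.mem_range.mpr (by omega))
    (Finset.mem_range.mpr (by omega)) (by omega)]
  · have hch : e.choose (e - 1) = e := by rw [Nat.choose_symm he, Nat.choose_one_right]
    rw [Nat.sub_self, pow_zero, Nat.choose_self, Nat.cast_one, mul_one, mul_one,
      show e - (e - 1) = 1 by omega, pow_one, show d - (e - 1) = d - e + 1 by omega, hch]
  · intro i _ hi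
    rcases lt_or_gt_of_ne hi.1 with h | h
    · rw [Nat.choose_eq_zero_of_lt h, Nat.cast_zero, mul_zero, mul_zero]
    · have : e < i := by omega
      rw [coeff_eq_zero_of_natDegree_lt (by omega), zero_mul, zero_mul]

/-- `(P : ℤ[X]) {d e : ℕ} (hP : P.natDegree = e) (hed : e ≤ d) (hP0 : P ≠ 0) (a : ℤ) {b : ℕ} (hb : b ≠ 0) : (scaleShift P d a b).natDegree = e`. -/
theorem natDegree_scaleShift (P : ℤ[X]) {d e : ℕ} (hP : P.natDegree = e) (hed : e ≤ d) (hP0 : P ≠ 0) (a : ℤ)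
    {b : ℕ} (hb : b ≠ 0) : (scaleShift P d a b).natDegree = e := by
  refine natDegree_eq_of_le_of_coeff_ne_zero ?_ ?_
  · exact natDegree_le_iff_coeff_eq_zero.mpr fun m hm => coeff_scaleShift_of_lt P hP.le a b hm
  · rw [coeff_scaleShift_self P hP.le hed, ← hP]
    exact mul_ne_zero (leadingCoeff_ne_zero.mpr hP0) (pow_ne_zero _ (by exact_mod_cast hb))

end Summit.Schanuel.Schanuel.Theorems.RootDecomp1KSectorTheorem
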